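import Mathlib
import Summits.QuantumFields.YangMills.Theorems.ScalingWindowSplitCurvatureAmnesiaWilsonSchwingerDyson
import Summits.QuantumFields.YangMills.Theorems.FemtoTransferGapBounds
import Summits.QuantumFields.YangMills.Theorems.FemtoTransferGapSlabGround
import HarnessLib

/-!
# Transport-field regularity kit, tranche 1: the Feynman–Hellmann derivative of the transfer kernel, of `K_βφ`, and of the vacuum
# `Ω = λ₀⁻¹K_βΩ` along a one-link shift

Support module for the transport-field / covariant-current programme (routes `TransportFieldFano`, `CovariantCurrentDoor` of planner ym-idea-4;
items ⟨stmt-QuantumFields-23381⟩ `CurrentStatePhysical`, ⟨23355⟩ `RobertsonInequality`, and the registered stubs `stub_cauchySchwarzCommutator`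
⟨23379⟩, `stub_robertsonB` ⟨23380⟩, `stub_linearSplit` ⟨23354⟩ — all of which quantify over `deriv (t ↦ Ω(U[e ↦ U_e·k(t)])) 0` and therefore
need the vacuum to be `C¹` ALONG ONE-LINK SHIFTS with integrable, direction-linear derivatives; Lean's `deriv` of a non-differentiable function
is `0`, so none of those statements is formal bookkeeping).

This tranche proves, for the fine `SU(2)` theory on `(ℤ/L)³`, a multiplicative family `k : ℝ → SU(2)` with `su2Rep (k t) = exp(tX)` and the LEFT
shift `T_t U = U[e ↦ k(t)U_e]` (a right shift `U_e k(t)` is the left shift by the conjugate family `U_e k(t) U_e⁻¹`, generator `Ad(U_e)X`):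
* `hasDerivAt_timeCoupling_shift` — `d/dt|₀ Σ_ℓ Re tr(U_ℓV_ℓ⁻¹) = Re tr(X U_e V_e⁻¹)`;
* `hasDerivAt_transferKernel_shift` — `d/dt|₀ K_β(T_tU, V) = K_β(U,V)·(β Re tr(XU_eV_e⁻¹) − (β/2) S'(U))` given a derivative `S'` of the
  Wilson action along the shift (tree `exists_hasDerivAt_wilsonAction_oneLink`);
* `hasDerivAt_transferApply_shift` — FEYNMAN–HELLMANN under the integral sign: for bounded measurable `φ`,
  `d/dt|₀ (K_βφ)(T_tU) = ∫ K_β(U,V)(β Re tr(XU_eV_e⁻¹) − (β/2)S'(U)) φ(V) dV` (bounded-Lipschitz differentiation under `∫` on the compact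
  configuration space: tree `hasDerivAt_integral_of_bounded_lipschitz`, `lipschitz_of_flow`);
* `hasDerivAt_vacuum_shift` — hence every physical solution of `K_βΩ = λ₀Ω` is differentiable along the shift, with derivative
  `λ₀⁻¹ ∫ K_β(U,V)(…)Ω(V) dV`; `exists_vacuum_shift_derivative` packages it with a uniform bound.
HONEST FRAMING: fixed-lattice calculus (femto rung R2b1); no claim about the cruxes, K2a, R2ξ″ or the YM mass gap.  No `sorry`, no new axiom,
no new definition.  References: M. Creutz, Quarks, gluons and lattices (CUP, 2022 ed.) Ch. 11 [cite: Creutz2022, Ch. 11]; [cite: ReedSimonIV1978, Thm. XIII.43];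
[cite: SeilerLNP1982, §3].
-/

set_option autoImplicit false

noncomputable section

open MeasureTheory Filter Topology NormedSpace
open scoped BigOperators Matrix.Norms.Frobenius
open Literature.MathematicalPhysics.QuantumFieldTheory (GaugeConfig Site Edge wilsonAction)
open Literature.MathematicalPhysics.QuantumLattice (secondCountableTopology_su2)
open Summit.QuantumFields.YangMills.Cruxes.CurvatureAmnesia.WardDefect.SchwingerDyson
  (shift_flow shift_zero hasDerivAt_factor hasDerivAt_reTrace exists_hasDerivAt_wilsonAction_oneLink)
open Summit.QuantumFields.YangMills.Theorems.EquipartitionPinsProbe.TangentSteinFiniteBeta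
  (hasDerivAt_of_flow lipschitz_of_flow exists_abs_le_of_continuous)
open Summit.QuantumFields.YangMills.Theorems.EquipartitionPinsProbe.TangentDiffIdentity
  (hasDerivAt_integral_of_bounded_lipschitz)

namespace Summit.QuantumFields.YangMills.Theorems.TransportField

open Summit.QuantumFields.YangMills.Theorems.FemtoTransferGap

variable {L : ℕ} [NeZero L] {k : ℝ → SU2} {X : Matrix (Fin 2) (Fin 2) ℂ}

/-! ## §1 The time coupling and the transfer kernel along the shift -/

/-- **`d/dt|₀ Σ_ℓ Re tr(U_ℓ V_ℓ⁻¹) = Re tr(X U_e V_e⁻¹)`** along `U ↦ U[e ↦ k(t)U_e]`, `su2Rep (k t) = exp(tX)`. [cite: Creutz2022, Ch. 11] -/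
theorem hasDerivAt_timeCoupling_shift (hX : ∀ t, su2Rep (k t) = exp ((t : ℂ) • X)) (e : Edge 3 L)
    (U V : GaugeConfig 3 L SU2) :
    HasDerivAt (fun t : ℝ => timeCoupling su2Rep (Function.update U e (k t * U e)) V)
      ((X * su2Rep (U e) * su2Rep ((V e)⁻¹)).trace.re) 0 := by
  unfold timeCoupling
  have h : HasDerivAt (fun t : ℝ => ∑ ℓ : Edge 3 L, ((su2Rep (Function.update U e (k t * U e) ℓ * (V ℓ)⁻¹)).trace).re)
      (∑ ℓ : Edge 3 L, ((if ℓ = e then X * su2Rep (U e) else 0) * su2Rep ((V ℓ)⁻¹)).trace.re) 0 := by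
    refine HasDerivAt.fun_sum fun ℓ _ => ?_
    have hf := hasDerivAt_reTrace ((hasDerivAt_factor su2Rep hX e ℓ U).mul_const (su2Rep ((V ℓ)⁻¹)))
    refine hf.congr_of_eventuallyEq (Eventually.of_forall fun t => ?_)
    simp only [map_mul]
  refine h.congr_deriv ?_
  rw [Finset.sum_eq_single e (fun ℓ _ hne => by simp [hne]) (fun h => absurd (Finset.mem_univ e) h)]
  simp only [if_true, Matrix.mul_assoc]

/-- **`d/dt|₀ K_β(T_tU, V) = K_β(U,V)·(β·Re tr(XU_eV_e⁻¹) − (β/2)·S'(U))`**, given a derivative `S'` of the Wilson action along the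
shift. [cite: Creutz2022, Ch. 11] [cite: SeilerLNP1982, §3] -/
theorem hasDerivAt_transferKernel_shift (hk : ∀ s t, k (s + t) = k s * k t) (hX : ∀ t, su2Rep (k t) = exp ((t : ℂ) • X))
    (β : ℝ) (e : Edge 3 L) (U V : GaugeConfig 3 L SU2) {S' : ℝ}
    (hS : HasDerivAt (fun t : ℝ => wilsonAction su2Rep (Function.update U e (k t * U e))) S' 0) :
    HasDerivAt (fun t : ℝ => transferKernel su2Rep β (Function.update U e (k t * U e)) V)
      (transferKernel su2Rep β U V * (β * (X * su2Rep (U e) * su2Rep ((V e)⁻¹)).trace.re - β / 2 * S')) 0 := by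
  have htc := hasDerivAt_timeCoupling_shift hX e U V
  have hin : HasDerivAt (fun t : ℝ => β * timeCoupling su2Rep (Function.update U e (k t * U e)) V -
      β / 2 * (wilsonAction su2Rep (Function.update U e (k t * U e)) + wilsonAction su2Rep V))
      (β * (X * su2Rep (U e) * su2Rep ((V e)⁻¹)).trace.re - β / 2 * S') 0 :=
    (htc.const_mul β).sub ((hS.add_const (wilsonAction su2Rep V)).const_mul (β / 2))
  have h := hin.exp
  simp only [shift_zero hk] at h
  unfold transferKernel
  exact h

/-! ## §2 Feynman–Hellmann: differentiating `K_βφ` under the integral sign -/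

omit [NeZero L] in
/-- The flow `(U, V) ↦ (T_tU, V)` on pairs of configurations. [folklore] -/
theorem pairShift_flow (hk : ∀ s t, k (s + t) = k s * k t) (e : Edge 3 L) (s t : ℝ)
    (p : GaugeConfig 3 L SU2 × GaugeConfig 3 L SU2) :
    (Function.update p.1 e (k (t + s) * p.1 e), p.2) =
      (Function.update (Function.update p.1 e (k s * p.1 e), p.2).1 e
        (k t * (Function.update p.1 e (k s * p.1 e), p.2).1 e), (Function.update p.1 e (k s * p.1 e), p.2).2) := by
  simp only [shift_flow hk e s t p.1]

/-- Continuity of the Feynman–Hellmann density `(U,V) ↦ K_β(U,V)(β Re tr(XU_eV_e⁻¹) − (β/2)S'(U))`. [folklore] -/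
theorem continuous_kernelDeriv (β : ℝ) (e : Edge 3 L) (X : Matrix (Fin 2) (Fin 2) ℂ) {S' : GaugeConfig 3 L SU2 → ℝ}
    (hS'c : Continuous S') :
    Continuous fun p : GaugeConfig 3 L SU2 × GaugeConfig 3 L SU2 =>
      transferKernel su2Rep β p.1 p.2 * (β * (X * su2Rep (p.1 e) * su2Rep ((p.2 e)⁻¹)).trace.re - β / 2 * S' p.1) := by
  have hK := continuous_transferKernel su2Rep (L := L) continuous_su2Rep β
  have h1 : Continuous fun p : GaugeConfig 3 L SU2 × GaugeConfig 3 L SU2 => su2Rep (p.1 e) :=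
    continuous_su2Rep.comp ((continuous_apply e).comp continuous_fst)
  have h2 : Continuous fun p : GaugeConfig 3 L SU2 × GaugeConfig 3 L SU2 => su2Rep ((p.2 e)⁻¹) :=
    continuous_su2Rep.comp (((continuous_apply e).comp continuous_snd).inv)
  have htr : Continuous fun p : GaugeConfig 3 L SU2 × GaugeConfig 3 L SU2 =>
      (X * su2Rep (p.1 e) * su2Rep ((p.2 e)⁻¹)).trace.re :=
    Complex.continuous_re.comp ((continuous_const.mul h1).mul h2).matrix_trace
  exact hK.mul ((continuous_const.mul htr).sub (continuous_const.mul (hS'c.comp continuous_fst)))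

/-- ★ **FEYNMAN–HELLMANN along a one-link shift.**  For bounded measurable `φ` and a continuous derivative `S'` of the Wilson action along
`U ↦ U[e ↦ k(t)U_e]` (`su2Rep (k t) = exp(tX)`):
`d/dt|₀ (K_βφ)(T_tU) = ∫ K_β(U,V)(β Re tr(XU_eV_e⁻¹) − (β/2)S'(U)) φ(V) dV`. [cite: Creutz2022, Ch. 11] [cite: SeilerLNP1982, §3] -/
theorem hasDerivAt_transferApply_shift (hk : ∀ s t, k (s + t) = k s * k t) (hX : ∀ t, su2Rep (k t) = exp ((t : ℂ) • X))
    (β : ℝ) (e : Edge 3 L) {φ : GaugeConfig 3 L SU2 → ℝ} (hφm : Measurable φ) {Cφ : ℝ} (hφb : ∀ V, |φ V| ≤ Cφ)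
    {S' : GaugeConfig 3 L SU2 → ℝ} (hS'c : Continuous S')
    (hS' : ∀ U, HasDerivAt (fun t : ℝ => wilsonAction su2Rep (Function.update U e (k t * U e))) (S' U) 0)
    (U : GaugeConfig 3 L SU2) :
    HasDerivAt (fun t : ℝ => transferApply β φ (Function.update U e (k t * U e)))
      (∫ V, transferKernel su2Rep β U V * (β * (X * su2Rep (U e) * su2Rep ((V e)⁻¹)).trace.re - β / 2 * S' U) * φ V
        ∂(configMeasure SU2 L)) 0 := by
  haveI : SecondCountableTopology SU2 := secondCountableTopology_su2
  -- the Feynman–Hellmann density and its bound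
  set D : GaugeConfig 3 L SU2 × GaugeConfig 3 L SU2 → ℝ := fun p =>
    transferKernel su2Rep β p.1 p.2 * (β * (X * su2Rep (p.1 e) * su2Rep ((p.2 e)⁻¹)).trace.re - β / 2 * S' p.1) with hD
  have hDc : Continuous D := continuous_kernelDeriv β e X hS'c
  obtain ⟨CD, hCD0, hCD⟩ := exists_abs_le_of_continuous hDc
  have hKc := continuous_transferKernel su2Rep (L := L) continuous_su2Rep β
  obtain ⟨CK, hCK0, hCK⟩ := exists_abs_le_of_continuous hKc
  -- the kernel along the pair flow: derivative `D` everywhere, hence Lipschitz in `t`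
  set T : ℝ → GaugeConfig 3 L SU2 × GaugeConfig 3 L SU2 → GaugeConfig 3 L SU2 × GaugeConfig 3 L SU2 :=
    fun t p => (Function.update p.1 e (k t * p.1 e), p.2) with hT
  have hflow : ∀ s t p, T (t + s) p = T t (T s p) := fun s t p => pairShift_flow hk e s t p
  have hd : ∀ p, HasDerivAt (fun t => transferKernel su2Rep β (T t p).1 (T t p).2) (D p) 0 :=
    fun p => hasDerivAt_transferKernel_shift hk hX β e p.1 p.2 (hS' p.1)
  have hlip : ∀ p t s, |transferKernel su2Rep β (T t p).1 (T t p).2 - transferKernel su2Rep β (T s p).1 (T s p).2| ≤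
      CD * |t - s| :=
    fun p t s => lipschitz_of_flow T hflow (fun p => transferKernel su2Rep β p.1 p.2) D hd hCD p t s
  have hCφ0 : 0 ≤ Cφ := (abs_nonneg _).trans (hφb U)
  -- differentiate under the integral sign
  have hmain := hasDerivAt_integral_of_bounded_lipschitz (configMeasure SU2 L)
    (fun t V => transferKernel su2Rep β (Function.update U e (k t * U e)) V * φ V)
    (fun V => D (U, V) * φ V) ((CK + CD) * Cφ)
    (fun t => ((continuous_transferKernel_right β _).measurable).mul hφm)
    ((hDc.comp (Continuous.prodMk_right U)).measurable.mul hφm)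
    (fun t V => by
      rw [abs_mul]
      have h1 : |transferKernel su2Rep β (Function.update U e (k t * U e)) V| ≤ CK + CD := (hCK (_, V)).trans (by linarith)
      exact mul_le_mul h1 (hφb V) (abs_nonneg _) (by linarith))
    (fun V t s => by
      rw [← sub_mul, abs_mul]
      have h1 := hlip (U, V) t s
      simp only [hT] at h1
      have h2 : |transferKernel su2Rep β (Function.update U e (k t * U e)) V -
          transferKernel su2Rep β (Function.update U e (k s * U e)) V| ≤ (CK + CD) * |t - s| :=
        h1.trans (mul_le_mul_of_nonneg_right (by linarith) (abs_nonneg _))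
      calc |transferKernel su2Rep β (Function.update U e (k t * U e)) V -
              transferKernel su2Rep β (Function.update U e (k s * U e)) V| * |φ V|
          ≤ (CK + CD) * |t - s| * Cφ := mul_le_mul h2 (hφb V) (abs_nonneg _) (by positivity)
        _ = (CK + CD) * Cφ * |t - s| := by ring)
    (fun V => by
      have h := (hd (U, V)).mul_const (φ V)
      simp only [hT] at h
      exact h)
  exact hmain

/-! ## §3 The vacuum is differentiable along one-link shifts -/

/-- ★★ **The vacuum is `C¹` along one-link shifts.**  If `Ω` is physical with `K_βΩ = λ₀Ω` (pointwise) and `S'` is a continuous derivative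
of the Wilson action along `U ↦ U[e ↦ k(t)U_e]`, then `t ↦ Ω(T_tU)` is differentiable at `0` with derivative
`λ₀⁻¹ ∫ K_β(U,V)(β Re tr(XU_eV_e⁻¹) − (β/2)S'(U)) Ω(V) dV`. [cite: ReedSimonIV1978, Thm. XIII.43] [cite: Creutz2022, Ch. 11] -/
theorem hasDerivAt_vacuum_shift (hk : ∀ s t, k (s + t) = k s * k t) (hX : ∀ t, su2Rep (k t) = exp ((t : ℂ) • X))
    (β : ℝ) (e : Edge 3 L) {Ω : GaugeConfig 3 L SU2 → ℝ} (hΩ : IsPhys Ω)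
    (heig : transferApply β Ω = topValue su2Rep L β • Ω)
    {S' : GaugeConfig 3 L SU2 → ℝ} (hS'c : Continuous S')
    (hS' : ∀ U, HasDerivAt (fun t : ℝ => wilsonAction su2Rep (Function.update U e (k t * U e))) (S' U) 0)
    (U : GaugeConfig 3 L SU2) :
    HasDerivAt (fun t : ℝ => Ω (Function.update U e (k t * U e)))
      ((topValue su2Rep L β)⁻¹ *
        ∫ V, transferKernel su2Rep β U V * (β * (X * su2Rep (U e) * su2Rep ((V e)⁻¹)).trace.re - β / 2 * S' U) * Ω V
          ∂(configMeasure SU2 L)) 0 := by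
  obtain ⟨C, hC⟩ := hΩ.bounded
  have h := (hasDerivAt_transferApply_shift hk hX β e hΩ.measurable hC hS'c hS' U).const_mul ((topValue su2Rep L β)⁻¹)
  refine h.congr_of_eventuallyEq (Eventually.of_forall fun t => ?_)
  have hne : topValue su2Rep L β ≠ 0 := (topValue_su2Rep_pos L β).ne'
  have hW := congrFun heig (Function.update U e (k t * U e))
  simp only [Pi.smul_apply, smul_eq_mul] at hW
  show Ω _ = (topValue su2Rep L β)⁻¹ * transferApply β Ω _
  rw [hW, ← mul_assoc, inv_mul_cancel₀ hne, one_mul]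

/-- ★★ **Packaged form**: along every exponential one-link shift the vacuum has a derivative `DΩ(U)` at `t = 0` for EVERY `U`, uniformly
bounded in `U`. [cite: ReedSimonIV1978, Thm. XIII.43] [cite: Creutz2022, Ch. 11] -/
theorem exists_vacuum_shift_derivative (hk : ∀ s t, k (s + t) = k s * k t) (hX : ∀ t, su2Rep (k t) = exp ((t : ℂ) • X))
    (β : ℝ) (e : Edge 3 L) {Ω : GaugeConfig 3 L SU2 → ℝ} (hΩ : IsPhys Ω)
    (heig : transferApply β Ω = topValue su2Rep L β • Ω) :
    ∃ DΩ : GaugeConfig 3 L SU2 → ℝ, (∃ C : ℝ, ∀ U, |DΩ U| ≤ C) ∧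
      ∀ U, HasDerivAt (fun t : ℝ => Ω (Function.update U e (k t * U e))) (DΩ U) 0 := by
  haveI : SecondCountableTopology SU2 := secondCountableTopology_su2
  obtain ⟨S', hS'c, hS'⟩ := exists_hasDerivAt_wilsonAction_oneLink su2Rep continuous_su2Rep hk hX e
  obtain ⟨CΩ, hCΩ⟩ := hΩ.bounded
  have hDc : Continuous fun p : GaugeConfig 3 L SU2 × GaugeConfig 3 L SU2 =>
      transferKernel su2Rep β p.1 p.2 * (β * (X * su2Rep (p.1 e) * su2Rep ((p.2 e)⁻¹)).trace.re - β / 2 * S' p.1) :=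
    continuous_kernelDeriv β e X hS'c
  obtain ⟨CD, hCD0, hCD⟩ := exists_abs_le_of_continuous hDc
  haveI : IsProbabilityMeasure (configMeasure SU2 L) := by unfold configMeasure; infer_instance
  refine ⟨fun U => (topValue su2Rep L β)⁻¹ *
      ∫ V, transferKernel su2Rep β U V * (β * (X * su2Rep (U e) * su2Rep ((V e)⁻¹)).trace.re - β / 2 * S' U) * Ω V
        ∂(configMeasure SU2 L), ⟨(topValue su2Rep L β)⁻¹ * (CD * CΩ), fun U => ?_⟩,
    fun U => hasDerivAt_vacuum_shift hk hX β e hΩ heig hS'c hS' U⟩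
  have hlam : 0 < topValue su2Rep L β := topValue_su2Rep_pos L β
  rw [abs_mul, abs_of_pos (inv_pos.2 hlam)]
  refine mul_le_mul_of_nonneg_left ?_ (inv_pos.2 hlam).le
  have hpt : ∀ V, ‖transferKernel su2Rep β U V * (β * (X * su2Rep (U e) * su2Rep ((V e)⁻¹)).trace.re - β / 2 * S' U) * Ω V‖ ≤
      CD * CΩ := by
    intro V
    rw [Real.norm_eq_abs, abs_mul]
    have hCΩ0 : 0 ≤ CΩ := (abs_nonneg _).trans (hCΩ V)
    exact mul_le_mul (hCD (U, V)) (hCΩ V) (abs_nonneg _) hCD0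
  have h := norm_integral_le_of_norm_le_const (μ := configMeasure SU2 L) (Eventually.of_forall hpt)
  rw [Real.norm_eq_abs] at h
  simpa using h

end Summit.QuantumFields.YangMills.Theorems.TransportField

end
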